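/-
Copyright: b2b-lace packet (enumeration shard B, gen 11).  KERNEL-EXACT n-STEP LAW OF SIMPLE RANDOM WALK ON `ℤ^d`:
the binomial dimension recursion for the end-point counts, its identification with the tree's `srwLaw`, and a
ROW form that `decide +kernel` evaluates in polynomial time.  Pure combinatorics; d-generic; no numeral of the
record; nothing cited; no `sorry`.
-/
import Literature.Barriers.CriticalPhenomena.RigorousRGSmallParameterFracLaplacian
import HarnessLib

/-!
# Kernel-exact simple-random-walk end-point counts (the binomial dimension recursion)

CITATION HEADER (PLACEMENT v2). This module is part of a certified REPRODUCTION of: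
R. Fitzner, R. van der Hofstad, *Mean-field behavior for nearest-neighbor percolation in d > 10*,
Electron. J. Probab. 22 (2017), no. 43, 1–65 [FvdH17], and *Generalized approach to the non-backtracking
lace expansion*, Probab. Theory Related Fields 169 (2017), 1041–1119 [NoBLE17-I] (arXiv:1506.07977, 1506.07969).
Reproduces: the EXACT simple-random-walk data underneath the `Ivalue` table of the accompanying notebook
`SRW.nb` §1 — the `n = 0` rows `I_{0,l}(x) = p_l(x; d)` of the recursion (5.1) of [FvdH17] §5.1 and the walk
counts `c_l(x; d) = (2d)^l p_l(x; d)` that every seed certificate for `I_{n,0}(x; d)` consumes (Poisson /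
Taylor partial sums) — as KERNEL-EVALUABLE exact integers, proved equal to the tree's `n`-step law
`LongRangePhi4.srwLaw d l x` (defined by the one-step recursion).  Origin: build `lace`, GAPS G8 (δ) SPEC v1,
items (δ2)(ii) (this seat, enum2-g11) and (δ2)(i) (the shared "W-layer" of SEEDCERT-U / SEEDCERT-P).

## What is here (all `[folklore]`)

* `SrwCount.walk1 a y` — the number of `a`-step `±1` walks on `ℤ` from `0` to `y` (last-step recursion),
  `walk1_neg`;
* `SrwCount.coordD x j` (the `j`-th coordinate of `x : Fin d → ℤ`, `0` for `j ≥ d`), `SrwCount.uvec d i`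
  (the `i`-th unit vector, `0` for `i ≥ d`);
* `SrwCount.G x j m` — the number of `m`-step nearest-neighbour walks from `0` to `x` that use only the first
  `j` coordinate directions (for `x` supported there), by the BINOMIAL DIMENSION RECURSION
  `G x (j+1) m = Σ_{a+b=m} C(m,a) · walk1 a x_j · G x j b` (choose the positions of the `a` steps in
  direction `j`, a 1-D walk on them, an `(m-a)`-step walk in the first `j` directions on the rest);
* the SHIFT IDENTITY `G_succ_right`: `G x j (m+1) = Σ_{i<j} (G (x+e_i) j m + G (x-e_i) j m)` for `j ≤ d`
  (product rule of the binomial convolution, `Finset.sum_antidiagonal_choose_succ_mul`, and the 1-D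
  recursion) — i.e. `G · d ·` satisfies the defining recursion of `srwLaw`;
* **`srwLaw_eq_srwCount_div : srwLaw d m x = srwCount d m x / (2d)^m`** with `srwCount d m x := G x d m`;
* ROW FORMS for the kernel: `walk1Tab A a` (the row `[walk1 a 0, …, walk1 a A]`, reflected recursion) and
  `GRow L A x j` (the row `[G x j 0, …, G x j L]`), each level referring to the previous row ONCE, with the
  bridges `walk1K_eq`, `GRow_getD`, `srwCountRow_getD`, and `srwLaw_eq_srwLawQ :
  srwLaw d m x = ↑(srwLawQ L A x m)` (`srwLawQ` a computable rational) for `m ≤ L`, `|x_i| + L ≤ A`.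
  Kernel cost `O(d · L²)` big-integer operations per point (`d = 11`, `L = 28`: seconds; measured).
  DESIGN NOTE for users: do NOT hand `decide` the recursive `G` / `walk1` at real sizes — a doubly recursive
  definition whose recursive calls carry unevaluated arithmetic arguments is re-evaluated path by path by the
  kernel (exponential; measured: `walk1 22 0` does not finish in 10 min), whereas the row forms are linear.

## What is NOT here
No SRW integral, no table of the record, no dimension fixed (the two closing `example`s are sanity checks);
no cited fact, no named hypothesis.  The identification with `LatticeModels.SRW.count` / `SRW.prob` follows from
`SrwLawBridges.prob_eq_srwLaw` (not imported here).

## References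
* F. Spitzer, Principles of Random Walk, 2nd ed. (1976), §1 (P1.1–P1.3: the n-step transition function);
* R. Fitzner, R. van der Hofstad, [FvdH17] §5.1 (the quantities `I_{n,l}(x)`, recursion (5.1), `I_{0,l} = p_l`),
  notebook `SRW.nb` §1 (arXiv:1506.07977 anc).
-/

namespace Literature.Probability.FitznerVanDerHofstad2017

open Finset
open Literature.Barriers.CriticalPhenomena.LongRangePhi4 (srwLaw srwLaw_zero_apply srwLaw_succ_apply)

namespace SrwCount

variable {d : ℕ}

/-! ### One dimension -/

/-- `walk1 a y` = the number of `a`-step `±1` walks on `ℤ` from `0` to `y`, by the last-step recursion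
`walk1 (a+1) y = walk1 a (y-1) + walk1 a (y+1)`, `walk1 0 y = [y = 0]`. [folklore] -/
def walk1 : ℕ → ℤ → ℕ
  | 0, y => if y = 0 then 1 else 0
  | a + 1, y => walk1 a (y - 1) + walk1 a (y + 1)

/-- [folklore] -/
@[simp] theorem walk1_zero (y : ℤ) : walk1 0 y = if y = 0 then 1 else 0 := rfl

/-- [folklore] -/
theorem walk1_succ (a : ℕ) (y : ℤ) : walk1 (a + 1) y = walk1 a (y - 1) + walk1 a (y + 1) := rfl

/-- Reflection symmetry `walk1 a (-y) = walk1 a y`. [folklore] -/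
theorem walk1_neg : ∀ (a : ℕ) (y : ℤ), walk1 a (-y) = walk1 a y
  | 0, y => by simp
  | a + 1, y => by
      rw [walk1_succ, walk1_succ, show -y - 1 = -(y + 1) by ring, show -y + 1 = -(y - 1) by ring,
        walk1_neg a, walk1_neg a, add_comm]

/-! ### Coordinates and unit vectors indexed by `ℕ` -/

/-- The `j`-th coordinate of `x : Fin d → ℤ` (`0` if `j ≥ d`). [folklore] -/
def coordD (x : Fin d → ℤ) (j : ℕ) : ℤ := if h : j < d then x ⟨j, h⟩ else 0

/-- The `i`-th unit vector of `ℤ^d` (`0` if `i ≥ d`). [folklore] -/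
def uvec (d i : ℕ) : Fin d → ℤ := fun k => if (k : ℕ) = i then 1 else 0

/-- [folklore] -/
theorem uvec_val (j : Fin d) : uvec d (j : ℕ) = Pi.single j 1 := by
  funext k
  simp only [uvec, Pi.single_apply, Fin.ext_iff]

/-- [folklore] -/
theorem coordD_add_uvec {i : ℕ} (hi : i < d) (x : Fin d → ℤ) (k : ℕ) :
    coordD (x + uvec d i) k = coordD x k + if k = i then 1 else 0 := by
  unfold coordD
  by_cases hk : k < d
  · simp [hk, uvec]
  · have hki : k ≠ i := fun h => hk (h ▸ hi)
    simp [hk, hki]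

/-- [folklore] -/
theorem coordD_sub_uvec {i : ℕ} (hi : i < d) (x : Fin d → ℤ) (k : ℕ) :
    coordD (x - uvec d i) k = coordD x k - if k = i then 1 else 0 := by
  unfold coordD
  by_cases hk : k < d
  · simp [hk, uvec]
  · have hki : k ≠ i := fun h => hk (h ▸ hi)
    simp [hk, hki]

/-- `x = 0` iff all its coordinates vanish. [folklore] -/
theorem eq_zero_iff_coordD (x : Fin d → ℤ) : x = 0 ↔ ∀ i < d, coordD x i = 0 := by
  constructor
  · rintro rfl i hi
    simp [coordD, hi]
  · intro h
    funext k
    simpa [coordD, k.isLt] using h k k.isLt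

/-! ### The binomial dimension recursion -/

/-- `G x j m` = the number of `m`-step nearest-neighbour walks from `0` to `x` using only the first `j`
coordinate directions (meaningful for `x` supported on them): `G x 0 m = [m = 0]` and
`G x (j+1) m = Σ_{a+b=m} C(m,a) · walk1 a x_j · G x j b`. [folklore] -/
def G (x : Fin d → ℤ) : ℕ → ℕ → ℕ
  | 0, m => if m = 0 then 1 else 0
  | j + 1, m => ∑ ij ∈ antidiagonal m, m.choose ij.1 * (walk1 ij.1 (coordD x j) * G x j ij.2)

/-- [folklore] -/
@[simp] theorem G_zero (x : Fin d → ℤ) (m : ℕ) : G x 0 m = if m = 0 then 1 else 0 := by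
  rw [G]

/-- [folklore] -/
theorem G_succ (x : Fin d → ℤ) (j m : ℕ) :
    G x (j + 1) m = ∑ ij ∈ antidiagonal m, m.choose ij.1 * (walk1 ij.1 (coordD x j) * G x j ij.2) := by
  rw [G]

/-- `G x j m` reads only the coordinates `< j` of `x`. [folklore] -/
theorem G_congr {x x' : Fin d → ℤ} :
    ∀ (j : ℕ), (∀ i < j, coordD x i = coordD x' i) → ∀ m, G x j m = G x' j m
  | 0, _, m => by simp
  | j + 1, h, m => by
      rw [G_succ, G_succ, h j (Nat.lt_succ_self j)]
      exact sum_congr rfl fun ij _ => by rw [G_congr j (fun i hi => h i (Nat.lt_succ_of_lt hi)) ij.2]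

/-- At `m = 0` steps: `G x j 0 = [x_i = 0 for all i < j]`. [folklore] -/
theorem G_zero_steps (x : Fin d → ℤ) : ∀ j, G x j 0 = if (∀ i < j, coordD x i = 0) then 1 else 0
  | 0 => by simp
  | j + 1 => by
      rw [G_succ, Finset.Nat.antidiagonal_zero, sum_singleton, Nat.choose_zero_right, one_mul, walk1_zero,
        G_zero_steps x j]
      by_cases h1 : coordD x j = 0
      · by_cases h2 : ∀ i < j, coordD x i = 0
        · rw [if_pos h1, if_pos h2, one_mul, if_pos]
          intro i hi
          rcases Nat.lt_succ_iff_lt_or_eq.1 hi with hi | rfl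
          · exact h2 i hi
          · exact h1
        · rw [if_pos h1, if_neg h2, mul_zero, if_neg]
          exact fun h => h2 fun i hi => h i (Nat.lt_succ_of_lt hi)
      · rw [if_neg h1, zero_mul, if_neg]
        exact fun h => h1 (h j (Nat.lt_succ_self j))

/-- **Shift identity** (the product rule of the binomial convolution and the 1-D recursion): for `j ≤ d`,
`G x j (m+1) = Σ_{i<j} (G (x + e_i) j m + G (x - e_i) j m)` — `G · j ·` satisfies the one-step recursion of
the simple random walk in the first `j` directions. [folklore] -/
theorem G_succ_right : ∀ {j : ℕ}, j ≤ d → ∀ (x : Fin d → ℤ) (m : ℕ),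
    G x j (m + 1) = ∑ i ∈ range j, (G (x + uvec d i) j m + G (x - uvec d i) j m)
  | 0, _, x, m => by simp
  | j + 1, hj, x, m => by
      have hjd : j < d := hj
      have key := Finset.sum_antidiagonal_choose_succ_mul (fun a b => walk1 a (coordD x j) * G x j b) m
      simp only [Nat.cast_id] at key
      rw [G_succ, key, sum_range_succ]
      congr 1
      · -- steps in the first `j` directions: induction hypothesis at every `b`, then regroup
        have ih : ∀ b, G x j (b + 1) = ∑ i ∈ range j, (G (x + uvec d i) j b + G (x - uvec d i) j b) :=
          fun b => G_succ_right (Nat.le_of_succ_le hj) x b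
        simp_rw [ih, mul_sum, sum_comm (s := antidiagonal m)]
        refine sum_congr rfl fun i hi => ?_
        have hij : i < j := mem_range.1 hi
        rw [G_succ, G_succ, coordD_add_uvec (lt_trans hij hjd), coordD_sub_uvec (lt_trans hij hjd),
          if_neg (Nat.ne_of_gt hij), add_zero, sub_zero, ← sum_add_distrib]
        exact sum_congr rfl fun ij _ => by ring
      · -- a step in direction `j`: the 1-D recursion at coordinate `j`
        rw [G_succ, G_succ, coordD_add_uvec hjd, coordD_sub_uvec hjd, if_pos rfl, ← sum_add_distrib]
        refine sum_congr rfl fun ij hij => ?_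
        have hab : ij.1 + ij.2 = m := mem_antidiagonal.1 hij
        have hplus : G (x + uvec d j) j ij.2 = G x j ij.2 :=
          G_congr j (fun i hi => by rw [coordD_add_uvec hjd, if_neg (Nat.ne_of_lt hi), add_zero]) ij.2
        have hminus : G (x - uvec d j) j ij.2 = G x j ij.2 :=
          G_congr j (fun i hi => by rw [coordD_sub_uvec hjd, if_neg (Nat.ne_of_lt hi), sub_zero]) ij.2
        rw [hplus, hminus, walk1_succ, ← Nat.choose_symm_of_eq_add hab.symm]
        ring

/-- The exact number of `m`-step nearest-neighbour walks on `ℤ^d` from `0` to `x`. [folklore] -/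
def srwCount (d m : ℕ) (x : Fin d → ℤ) : ℕ := G x d m

/-- **The `n`-step law of simple random walk is the binomial-recursion count over `(2d)^n`**:
`srwLaw d m x = srwCount d m x / (2d)^m` (both sides are the junk value `0` for `d = 0`, `m ≥ 1`). [folklore] -/
theorem srwLaw_eq_srwCount_div : ∀ (m : ℕ) (x : Fin d → ℤ),
    srwLaw d m x = (srwCount d m x : ℝ) / (2 * d : ℝ) ^ m
  | 0, x => by
      rw [srwLaw_zero_apply, srwCount, G_zero_steps, pow_zero, div_one]
      by_cases hx : x = 0
      · rw [if_pos hx, if_pos ((eq_zero_iff_coordD x).1 hx), Nat.cast_one]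
      · rw [if_neg hx, if_neg (fun h => hx ((eq_zero_iff_coordD x).2 h)), Nat.cast_zero]
  | m + 1, x => by
      rw [srwLaw_succ_apply, srwCount, G_succ_right le_rfl x m]
      simp_rw [srwLaw_eq_srwCount_div m, srwCount, ← uvec_val]
      rw [Fin.sum_univ_eq_sum_range (fun i => (G (x + uvec d i) d m : ℝ) / (2 * d : ℝ) ^ m +
            (G (x - uvec d i) d m : ℝ) / (2 * d : ℝ) ^ m) d,
        Finset.sum_div, Nat.cast_sum, Finset.sum_div]
      refine sum_congr rfl fun i _ => ?_
      push_cast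
      rw [← add_div, div_div, pow_succ]

/-! ### Row forms for the kernel -/

/-- `((List.range n).map f).getD i a = f i` for `i < n`. [folklore] -/
theorem getD_map_range {α : Type*} (f : ℕ → α) {n i : ℕ} (h : i < n) (a : α) :
    ((List.range n).map f).getD i a = f i := by
  rw [List.getD_eq_getElem?_getD, List.getElem?_map, List.getElem?_range h]
  rfl

/-- `((List.range n).map g).sum = Σ_{k<n} g k`. [folklore] -/
theorem sum_map_range {β : Type*} [AddCommMonoid β] (g : ℕ → β) (n : ℕ) :
    ((List.range n).map g).sum = ∑ k ∈ range n, g k := by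
  induction n with
  | zero => simp
  | succ n ih => rw [List.range_succ, List.map_append, List.sum_append, ih, sum_range_succ]; simp

/-- ROW FORM of the 1-D counts: `walk1Tab A a = [walk1 a 0, walk1 a 1, …, walk1 a A]` as long as `a + y ≤ A`
(reflected recursion at `y = 0`; one reference to the previous row). [folklore] -/
def walk1Tab (A : ℕ) : ℕ → List ℕ
  | 0 => (List.range (A + 1)).map fun y => if y = 0 then 1 else 0
  | a + 1 =>
      let prev := walk1Tab A a
      (List.range (A + 1)).map fun y =>
        if y = 0 then 2 * prev.getD 1 0 else prev.getD (y - 1) 0 + prev.getD (y + 1) 0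

/-- [folklore] -/
theorem walk1Tab_getD {A : ℕ} : ∀ (a y : ℕ), y + a ≤ A → (walk1Tab A a).getD y 0 = walk1 a y
  | 0, y, h => by
      rw [walk1Tab, getD_map_range _ (by omega), walk1_zero]
      simp
  | a + 1, y, h => by
      rw [walk1Tab, getD_map_range _ (by omega), walk1_succ]
      by_cases hy : y = 0
      · subst hy
        rw [if_pos rfl, walk1Tab_getD a 1 (by omega), Nat.cast_zero, zero_sub, zero_add, walk1_neg,
          Nat.cast_one, two_mul]
      · rw [if_neg hy, walk1Tab_getD a (y - 1) (by omega), walk1Tab_getD a (y + 1) (by omega),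
          show ((y - 1 : ℕ) : ℤ) = (y : ℤ) - 1 by omega, show ((y + 1 : ℕ) : ℤ) = (y : ℤ) + 1 by omega]

/-- Kernel form of `walk1 a c` (valid for `|c| + a ≤ A`). [folklore] -/
def walk1K (A a : ℕ) (c : ℤ) : ℕ := (walk1Tab A a).getD c.natAbs 0

/-- [folklore] -/
theorem walk1K_eq {A a : ℕ} {c : ℤ} (h : c.natAbs + a ≤ A) : walk1K A a c = walk1 a c := by
  rw [walk1K, walk1Tab_getD a _ h]
  rcases Int.natAbs_eq c with hc | hc
  · rw [← hc]
  · conv_rhs => rw [hc, walk1_neg]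

/-- ROW FORM of the dimension recursion: `GRow L A x j = [G x j 0, …, G x j L]` as long as `|x_i| + L ≤ A`
for `i < j` (one reference to the previous row per level). [folklore] -/
def GRow (L A : ℕ) (x : Fin d → ℤ) : ℕ → List ℕ
  | 0 => (List.range (L + 1)).map fun m => if m = 0 then 1 else 0
  | j + 1 =>
      let prev := GRow L A x j
      (List.range (L + 1)).map fun m =>
        ((List.range (m + 1)).map fun a => m.choose a * walk1K A a (coordD x j) * prev.getD (m - a) 0).sum

/-- [folklore] -/
theorem GRow_getD {L A : ℕ} {x : Fin d → ℤ} :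
    ∀ (j : ℕ), (∀ i < j, (coordD x i).natAbs + L ≤ A) → ∀ m ≤ L, (GRow L A x j).getD m 0 = G x j m
  | 0, _, m, hm => by
      rw [GRow, getD_map_range _ (by omega), G_zero]
  | j + 1, hA, m, hm => by
      rw [GRow, getD_map_range _ (by omega), sum_map_range, G_succ, Finset.Nat.sum_antidiagonal_eq_sum_range_succ_mk]
      refine sum_congr rfl fun a ha => ?_
      have ha' : a ≤ m := Nat.lt_succ_iff.1 (mem_range.1 ha)
      have hj := hA j (Nat.lt_succ_self j)
      rw [walk1K_eq (by omega), GRow_getD j (fun i hi => hA i (Nat.lt_succ_of_lt hi)) (m - a) (by omega),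
        mul_assoc]

/-- Kernel row of the end-point counts `[srwCount d 0 x, …, srwCount d L x]` (requires `|x_i| + L ≤ A`).
[folklore] -/
def srwCountRow (L A : ℕ) (x : Fin d → ℤ) : List ℕ := GRow L A x d

/-- [folklore] -/
theorem srwCountRow_getD {L A m : ℕ} {x : Fin d → ℤ} (hA : ∀ i : Fin d, (x i).natAbs + L ≤ A) (hm : m ≤ L) :
    (srwCountRow L A x).getD m 0 = srwCount d m x := by
  refine GRow_getD d (fun i hi => ?_) m hm
  simpa [coordD, hi] using hA ⟨i, hi⟩

/-- Kernel form of the `m`-step law: the exact RATIONAL `p_m(x; d) = srwCount d m x / (2d)^m` read off the row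
(requires `m ≤ L`, `|x_i| + L ≤ A`). [folklore] -/
def srwLawQ (L A : ℕ) (x : Fin d → ℤ) (m : ℕ) : ℚ := ((srwCountRow L A x).getD m 0 : ℚ) / (2 * d : ℚ) ^ m

/-- **`srwLaw d m x = ↑(srwLawQ L A x m)`** for `m ≤ L`, `|x_i| + L ≤ A`: the tree's `n`-step law as a
kernel-evaluable rational. [folklore] -/
theorem srwLaw_eq_srwLawQ {L A m : ℕ} {x : Fin d → ℤ} (hA : ∀ i : Fin d, (x i).natAbs + L ≤ A) (hm : m ≤ L) :
    srwLaw d m x = ((srwLawQ L A x m : ℚ) : ℝ) := by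
  rw [srwLaw_eq_srwCount_div, srwLawQ, srwCountRow_getD hA hm]
  push_cast
  rfl

/-- Sanity (d = 2): two 2-step walks reach `(1,1)`, `p₂((1,1)) = 2/16`. [folklore] -/
example : srwLawQ 4 6 ![(1 : ℤ), 1] 2 = 1 / 8 := by decide +kernel

/-- Sanity (d = 11, the table range of [FvdH17]): the number of 27-step walks from `0` to `e₁ + 4e₂` in `ℤ¹¹`
(cross-checked against an independent composition-sum enumeration, build `lace` enumeration shard B). [folklore] -/
example : (srwCountRow 28 33 (![1, 4, 0, 0, 0, 0, 0, 0, 0, 0, 0] : Fin 11 → ℤ)).getD 27 0 =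
    51601739532664940148270260520 := by
  decide +kernel

end SrwCount

end Literature.Probability.FitznerVanDerHofstad2017
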